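import Mathlib
import Literature.Computability.Complexity.RangeAvoidance
import Literature.Computability.Complexity.SignDegreeXor
import Summits.PneNP.PneNP.Theorems.SASubThreshold
import Summits.PneNP.PneNP.Theorems.PairwiseSALinear
import Summits.PneNP.PneNP.Theorems.PstarTypedLaws
import Summits.PneNP.PneNP.Theorems.PstarDensityExist

/-!
# HEADLINE-23-B `PstarSASubThresholdBlind`: Sherali–Adams is blind for `NC⁰₄` range avoidance below `n^{3/2}` (cell `pnp-ideate`, ROUND-23)

FRONTIER range-avoidance ladder, rung F-N3 context (restricted-model lower bounds for the Sherali–Adams hierarchy; nothing here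
bears on `P` vs `NP`).  The headline `SASubThreshold.PstarSASubThresholdBlind` BY NAME, assembled by p3's wiring
`SASubThreshold.pstarSASubThresholdBlind_of` from its three suppliers, all theorems of the tree:
* the hub `PairwiseSA.pairwiseSALinearLevel` (T22.0, prover-2): pairwise-independent fibre laws with variable-consistent biases
  + `(r, a/b)`-boundary expansion with `a/b > k − 3` ⇒ SA feasibility at level `r/c`;
* `PstarTypedLaws.typedPairwiseLaws` (T23.1-C): the typed `P⋆` fibre laws (XOR variables `1/2`, AND variables `1/√2`);
* `PstarDensityExist.pstarExpandingDensity` (T23.1-B): density-uniform `(r, (t+1)/t)`-boundary-expanding typed pure-`P⋆`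
  instances with `Δ·n` outputs for every radius `r` with `c·Δ^{2t}·r^{t−1} ≤ n^{t−1}`.
Reading: for every `t ≥ 2` there is `c > 0` such that for every density `Δ ≥ 2` and infinitely many `n` some pure-`P⋆` `4`-local
map with `Δ·n` outputs has a point outside its range while level-`r` Sherali–Adams is feasible for EVERY target whenever
`c·Δ^{2t}·r^{t−1} ≤ n^{t−1}` — polynomial blind level at every stretch `m = n^{3/2−ε}`, i.e. exactly below the print threshold
`m ≳ n^{3/2}` of GuruswamiLyuYuan2025 (whose certificates are spectral, not SA — honest scope as in `SASubThreshold`).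
-/

set_option linter.dupNamespace false

namespace Summit.PneNP.PneNP.Theorems.SASubThreshold

/-- **HEADLINE-23-B holds**: `PstarSASubThresholdBlind`, from the hub, the typed laws and density-uniform typed expansion. -/
theorem pstarSASubThresholdBlind : PstarSASubThresholdBlind :=
  pstarSASubThresholdBlind_of PairwiseSA.pairwiseSALinearLevel PstarTypedLaws.typedPairwiseLaws
    PstarDensityExist.pstarExpandingDensity

end Summit.PneNP.PneNP.Theorems.SASubThreshold
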